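import Mathlib
import HarnessLib
import HarnessLib.Audit
import Summits.MatrixMultiplication.Statement
import Literature.Computability.AlgebraicComplexity.CohnUmansTPP
import Literature.Computability.AlgebraicComplexity.CohnUmansTPPProofs
import Literature.Barriers.MatrixMultiplication.NormalizerBarrier

/-!
Route: SnThresholdCensus

CLOSED (refuted) 2026-08-16T08:27:47Z by planner-rchoice-MatrixMultiplication-SnThresho-4dc7a448-0 — reason: refuted:stmt-MatrixMultiplication-10879 (ThresholdSubgroupTriples) by Summit.MatrixMultiplication.MatrixMultiplication.Theorems.SnThresholdCensusThresholdSubgroupTriples_refuted — note: route-choice (substantive): target X = ThresholdSubgroupTriples (stmt-10879) refuted by Theorems.SnThresholdCensusThresholdSubgroupTriples_refuted via the subgroup-pivot sieve (Theorems/HyperoctahedralThreshold/Negative/SubgroupPivotSieve: TPP(H,X1,X2) with H a subgroup => |H||X1||X2| <= |G| d_max(G. The file is kept as the record of this route; refuted decls are indexed as negative knowledge (`ledger negatives`).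

# Route SnThresholdCensus — threshold TPP subgroup triples in S_n decide omega = 2; the census by
host type is the negative side that settles it

X = THRESHOLD SUBGROUP TRIPLES (the deciding statement; D-0027 route repair 2026-08-15; realises the
constructive twin card
hyperoctahedral-matching-tpp and, through its negative side N = ¬X, card
sn-threshold-subgroup-census): for every c > 0 and every
n₀ there are n ≥ n₀ and subgroups H₁, H₂, H₃ ≤ S_n with the subgroup triple product property (h₁h₂h₃
= 1, hᵢ ∈ Hᵢ ⇒ h₁ = h₂ =
h₃ = 1; the tree's `SubgroupTPP`, = Cohn–Umans TPP since Q(H) = H) and |H₁||H₂||H₃| >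
(n!)^{3/2}·e^{−c√n} — TPP subgroup triples
of S_n at the ω = 2 threshold n!^{1/2}/e^{o(√n)} of BlasiakChurchCohnGrochowUmans2017 §4–5. X
DECIDES THE SUMMIT by the deciding
theorem `closes : ThresholdSubgroupTriples → VershikKerovBound → MatrixMultiplication`, PROVED
sorry-free in this file: X + the
Vershik–Kerov bound d_max(S_n) ≤ √(n!)e^{−c₁√n} (support item, VershikKerov1985 Thm 1) ⇒ ω(ℂ) = 2
through the Cohn–Umans
inequality CKSU 2005 Cor 1.9 ((nmp)^{ω/3} ≤ d_max^{ω−2}|G|), which is PROVED in the tree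
(`CKSU2005_cor19_holds`,
Literature/Computability/AlgebraicComplexity/CohnUmansTPPProofs) and is used inside the proof, not
assumed. The route is TWO-SIDED
and is decided by exactly one of X and N = NoThresholdSubgroupTriple (kept as the rank-0 crux —
CensusReduction names the decl — with `ThresholdIffNotCensus`:
N ↔ ¬X, pure logic): the ranked cruxes are the CENSUS BY HOST TYPE expected to prove N — BCCGU17 Thm
4.2 (three Young subgroups lose e^{Ω(n)})
extended to ALL subgroup triples, the "smaller step" posed in BCCGU17 §5 — while every refutation of
a census crux is a threshold
family, i.e. a proof of X and of ω(ℂ) = 2. Honest reading: N is the likely truth (a negative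
milestone that closes the S_n /
A_n-subgroup line of CNonabelianTPPFamilies, route GroupTheoreticSTPP); X is what the summit needs;
the census is the cheapest way
to settle which, and the deciding theorem makes the positive outcome count the moment it happens.
Lean: `∀ c : ℝ, 0 < c → ∀ n₀ : ℕ, ∃ n ≥ n₀, ∃ H : Fin 3 → Subgroup (Equiv.Perm (Fin n)),
Literature.Barriers.MatrixMultiplication.SubgroupTPP (H 0) (H 1) (H 2) ∧ (n.factorial : ℝ) ^ ((3 :
ℝ) / 2) * Real.exp (-(c * Real.sqrt (n : ℝ))) < ((Nat.card (H 0) * Nat.card (H 1) * Nat.card (H 2) :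
ℕ) : ℝ)`

## Assembly
Deciding theorem (D-0027 §2.1), proved in the route file with axioms {propext, Classical.choice,
Quot.sound}:
`closes : ThresholdSubgroupTriples → VershikKerovBound → MatrixMultiplication`. Proof (elementary
real analysis over two tree
theorems): if ω := omega ℂ ≠ 2 then ω > 2 (`omega_two_le`); put ε := ω − 2 > 0 and apply X with c :=
c₁ε and n₀ := n₁ (c₁, n₁
from VershikKerovBound): a subgroup TPP triple in S_n, n ≥ n₁, with N := |H₁||H₂||H₃| >
(n!)^{3/2}e^{−c₁ε√n}. The three subgroups
as finsets realise ⟨|H₁|,|H₂|,|H₃|⟩ (`subgroupTPP_iff_tripleProductProperty`,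
`Fintype.card_subtype`), so Cor 1.9
(`CKSU2005_cor19_holds`, |S_n| = n! by `Fintype.card_perm`) gives N^{ω/3} ≤ d_max(S_n)^{ε}·n! ≤
(√(n!)e^{−c₁√n})^{ε}·n! =
(n!)^{ω/2}e^{−c₁ε√n}, while N^{ω/3} > ((n!)^{3/2}e^{−c₁ε√n})^{ω/3} = (n!)^{ω/2}e^{−c₁ε(ω/3)√n} ≥
(n!)^{ω/2}e^{−c₁ε√n} because
ω ≤ 3 (`omega_le_three'`) — contradiction; hence ω(ℂ) = 2 (`MatrixMultiplication_iff`). Hypotheses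
are exactly the two items
ThresholdSubgroupTriples and VershikKerovBound. Off the deciding theorem, the census composes to N:
CensusReduction ∘
PartitionHostTriples ⇒ N (modus ponens), with HyperoctahedralTriples and AlmostDisjointYoungBound
the two engines inside
PartitionHostTriples; N ⇒ ¬X (`ThresholdIffNotCensus`) then refutes the target and the route closes
`refuted:ThresholdSubgroupTriples`, keeping the negative milestone in Theorems. The item `Assembly`
(formerly the hypothesis form
¬N → CKSU2005_cor19 → VershikKerovBound → summit, whose two non-item hypotheses were the gate
bounce) is RESTATED as the deciding
implication itself, ThresholdSubgroupTriples → VershikKerovBound → MatrixMultiplication — provable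
now: it is the type of `closes`
(a prover closes it with `theorem Assembly_holds : Assembly := closes`).

Rationale: WHY THIS LINE. REPAIR 2026-08-15 (D-0027 §2.1, route-repair planner): the deciding side X =
ThresholdSubgroupTriples is now the target and the
deciding theorem `closes : ThresholdSubgroupTriples → VershikKerovBound → MatrixMultiplication` is
proved in the file (§ Thesis / Assembly;
CKSU Cor 1.9 is the tree theorem `CKSU2005_cor19_holds`, used inside the proof); the census below is
unchanged and is the route's negative
side N = NoThresholdSubgroupTriple (rank-0 crux, since CensusReduction names the decl;
`ThresholdIffNotCensus`: N ↔ ¬X). Pairwise counting (|Hᵢ||Hⱼ| ≤ n! when Hᵢ ∩ Hⱼ = 1, tree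
`card_mul_card_le_card_inf_mul_card`) reduces N to BALANCED triples, all three of order
√(n!)·e^{±O(√n)}; at that order O'Nan–Scott
leaves no primitive groups (PraegerSaxl1980, Maroti2002: |H| ≤ 4ⁿ unless H ≥ A_n), so threshold
subgroups are built from orbits and
blocks — Young-like products S_a^b with a ≈ √(en), the hyperoctahedral groups B_m = S_2 ≀ S_m (|B_m|
= √(n!)(πn/2)^{1/4}, the one
transitive family), giant alternating blocks with thin junk (A_{n/2} × Syl₂), diagonal subgroups A_D
× diag(S_m) (BCCGU's S_n × S_n
warning, realised inside S_n) and mixtures (DixonMortimer1996 Ch. 4–5). The line files one crux per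
host type instead of the card's
(false as stated) single structure lemma: the hyperoctahedral family is the knife edge — rooted
matching stabilisers are PAIRWISE
trivial at (n!)^{3/2}/n³ (support item PairwiseTrivialAtThreshold), so unlike the Young case
(BlasiakChurchCohnGrochowUmans2017 Thm 4.2
uses only pairwise-trivial intersections) the genuine triple condition must be used; capped
partition hosts N(S_λ) carry the
Young-like and mixed types, where the meets-≤-2 extension of Thm 4.2 and the PROVED normaliser
barrier (BlasiakCohnGrochowPrattUmans2023
Thm 3.6 = tree `SubgroupTPP.normalizer_barrier`, an ally here) do the work; a reduction crux absorbs
giant/diagonal/thin types. On the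
positive side X is exactly the S_n-subgroup instance of CNonabelianTPPFamilies (route
GroupTheoreticSTPP) at the weakest size that still
gives ω = 2: d_max(S_n) = √(n!)e^{−Θ(√n)} (VershikKerov1985) leaves room e^{o(√n)} below (n!)^{3/2},
and a TPP triple inside that room
for every c forces ω(ℂ) = 2 by Cor 1.9 — the content of `closes`. Imported areas: permutation-group
structure theory (orbits, blocks,
orders of primitive groups, subgroups of small index), asymptotic representation theory of S_n
(VershikKerov1985, LoganShepp1977) for the
deciding theorem, combinatorics of set partitions and perfect matchings; the subgroup-capacity
literature (Neumann2011, Hedtke2011 =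
arXiv:1107.5969, HedtkeMurthy2012) records the folklore belief that subgroup triples never give
non-trivial ω but has bounds only via
cores/normal subgroups and data for |G| ≤ 1000. What no prior route or card does: an exact Lean
target for BCCGU's open step WITH A
PROVED DECIDING THEOREM to ω = 2, a host-type decomposition of its negative side, and the recorded
fact that pairwise arguments provably
cannot suffice.

RANKED CRUXES. #0 ThresholdSubgroupTriples (target, NEW 2026-08-15) — X as in § Thesis: for every c
> 0 and n₀ there are n ≥ n₀ and a subgroup TPP triple of S_n with |H₁||H₂||H₃| > (n!)^{3/2}
e^{−c√n}; hypothesis of `closes`; the positive form of ¬NoThresholdSubgroupTriple (card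
hyperoctahedral-matching-tpp C2 read for subgroups, generalised to arbitrary subgroup hosts). (why
it might fail: Probably false — it is ¬N and the census (ranks 2–5) is built to prove N: Young
triples lose e^{Ω(n)} (BCCGU17 Thm 4.2), folklore says subgroup triples never help (Hedtke2011), and
a balanced triple has ≈ √(n!)·n^{−3/2} expected TPP violations heuristically; only a structural
miracle on the hyperoctahedral knife edge saves it.) [BlasiakChurchCohnGrochowUmans2017,
arXiv:1712.02302, CohnKleinbergSzegedyUmans2005, Hedtke2011, arXiv:1107.5969, VershikKerov1985,
lean:Literature.Computability.AlgebraicComplexity.CKSU2005_cor19_holds]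
#0' NoThresholdSubgroupTriple (crux, rank 0; the target until 2026-08-15, re-badged: it is N = ¬X
and does not bear on ω; it stays in the crux group at rank 0 only because CensusReduction (rank 4)
names the decl and must render after it — staff ranks 2–5, not N directly) — ∃ c > 0, n₀ such that
for n ≥ n₀ every subgroup triple of S_n with the subgroup TPP has |H₁||H₂||H₃| ≤ (n!)^{3/2} e^{−c√n}
(card sn-threshold-subgroup-census; the S_n / A_n subgroup-host half of ¬CNonabelianTPPFamilies).
Proved by modus ponens from CensusReduction and PartitionHostTriples the moment both close; its
proof refutes the target through ThresholdIffNotCensus and ends the route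
`refuted:ThresholdSubgroupTriples` with the negative milestone kept. (why it might fail: May be
false exactly on the hyperoctahedral knife edge: rooted matching stabilisers are pairwise trivial at
(n!)^{3/2}/n³, so only the genuine triple condition separates N from ω = 2, and no technique for
non-Young subgroups of S_n exists (BCCGU17 §5 open question).) [BlasiakChurchCohnGrochowUmans2017,
arXiv:1712.02302, Hedtke2011, arXiv:1107.5969, BlasiakCohnGrochowPrattUmans2023,
lean:Literature.Barriers.MatrixMultiplication.BCCGU2017_thm42]
#2 HyperoctahedralTriples (crux) — the knife-edge family (card crux 3 corrected to SUBGROUPS of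
matching stabilisers; = sibling card hyperoctahedral-matching-tpp C2 for subgroups): ∃ c > 0, n₀:
for n ≥ n₀, three fixed-point-free involutions μᵢ (perfect matchings Mᵢ) and subgroups Kᵢ ≤ C(μᵢ) =
B(Mᵢ) ≅ S_2 ≀ S_{n/2} with the subgroup TPP have |K₁||K₂||K₃| ≤ (n!)^{3/2} e^{−c√n}. Full conjugates
of B_m fail already pairwise (|B_m|² > n!); the content is index-≤ e^{O(√n)} subgroups such as the
rooted stabilisers B(Mᵢ) ∩ Stab(v₀). A refutation is a proof of X (and of ω = 2 by `closes`).
[difficulty: open-problem] (why it might fail: Pairwise counting is exhausted (Kᵢ = B(Mᵢ) ∩ Stab(v₀)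
pairwise trivial, only n³ below (n!)^{3/2}); B(M) is maximal and self-normalising so Thm 3.6 gives
nothing; if one matching triple satisfies (HAM) orbit separation the crux is false and ω = 2
follows.) [BlasiakChurchCohnGrochowUmans2017, BlasiakCohnGrochowPrattUmans2023, Macdonald1995,
JamesKerber1981, lean:Literature.Barriers.MatrixMultiplication.SubgroupTPP.normalizer_barrier]
#3 PartitionHostTriples (crux) — capped partition hosts (card cruxes 1–2, Young-like +
hyperoctahedral + mixed types in one host notion): for every C there are c > 0, n₀ such that for n ≥
n₀, labellings f₁,f₂,f₃ : [n] → [n] whose hosts N(S_{fᵢ}) = {σ : σ maps fibres of fᵢ to fibres} have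
order ≤ √(n!)·e^{C√n log n}, and subgroups Kᵢ ≤ N(S_{fᵢ}) with the subgroup TPP: |K₁||K₂||K₃| ≤
(n!)^{3/2} e^{−c√n}. Hosts include S_λ and S_a ≀ S_b (a ≤ (√e+o(1))√n), B_m (fibres = pairs), S_D ×
B (|D| ≈ √n); implies HyperoctahedralTriples. [deps: HyperoctahedralTriples,
AlmostDisjointYoungBound] [difficulty: XL] (why it might fail: Hosts up to √(n!)e^{C√n log n}
include S_a ≀ S_b (a ≈ √(en)) whose block-permuting top is not Young: BCCGU's induction controls
parts, not twisted/diagonal subgroups of the base, and mixed hosts S_D × B inherit the full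
hyperoctahedral difficulty of rank 2.) [BlasiakChurchCohnGrochowUmans2017, DixonMortimer1996,
BlasiakCohnGrochowPrattUmans2023,
lean:Literature.Barriers.MatrixMultiplication.SubgroupTPP.normalizer_barrier,
lean:Literature.Barriers.MatrixMultiplication.youngSubgroup]
#4 CensusReduction (crux; re-filed 2026-08-15 as stmt-MatrixMultiplication-10864 with the identical
term in parentheses, to clear a gate missing-decl block from the transient re-badge of N — the
refuter stamp of stmt-5538 (rc0 elaborates, 2026-08-15T13:58Z) applies verbatim) — the census proper
(card crux 1 in checkable form): PartitionHostTriples ⇒ N. Content: by pairwise counting only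
balanced triples matter (all |Hᵢ| = √(n!)e^{±O(√n)}); a balanced subgroup outside every capped
partition host is of giant-block type (A_D ≤ H with |D| ≥ n/2 − O(n/log n) and thin junk, e.g.
A_{n/2} × Syl₂), of diagonal type (A_D × diag(S_m) ≤ S_D × S_m × S_m) or a subdirect mixture, and
such subgroups admit no threshold TPP partners (forced intersections: partners must avoid A_D yet
have index e^{O(√n)}·n^{1/4} in some B(M) with M crossing D, whose diagonal S_{n/2} then meets any
thin junk). [deps: PartitionHostTriples] [difficulty: L] (why it might fail: A third balanced family
may escape both clauses: giant blocks with thin junk (A_{n/2} × Syl₂), diagonal type A_D × diag(S_m)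
— BCCGU's S_n × S_n warning realised inside S_n — and subdirect products each need their own
forced-intersection argument, none written.) [DixonMortimer1996, PraegerSaxl1980, Maroti2002,
BlasiakChurchCohnGrochowUmans2017, Hedtke2011, Neumann2011, HedtkeMurthy2012]
#5 AlmostDisjointYoungBound (crux) — BCCGU Thm 4.2 with meets of size ≤ 2 (the engine for the
Young-like part of rank 3): ∃ c, d > 0 such that for n ≥ 2 and labellings f₁,f₂,f₃ : [n] → [n] whose
pairwise meet fibres {x : fᵢx = a, fⱼx = b} (i ≠ j) have ≤ 2 elements, n!/(∏ᵢ∏ₐ |fᵢ⁻¹(a)|!)^{2/3} ≥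
e^{cn − d√n log n}. Group meaning: alternating Young cores A(λᵢ) := ∏_B A_B ≤ Hᵢ ≤ S(λᵢ) with Hᵢ ∩
Hⱼ = 1 force meets ≤ 2, and |S(λ)| = ∏|B|!; the vendored BCCGU2017_thm42 is the case of meets ≤ 1.
[difficulty: L] (why it might fail: With meets of size 2 the t-large step of BCCGU's induction
breaks (the other partitions need only t/2 parts) and doubled shapes (rows / columns / doubled
diagonals of a √n-grid) gain 4^n-type factors, so c must drop below BCCGU's; an unforeseen doubled
shape could push the deficit to e^{o(n)}.) [BlasiakChurchCohnGrochowUmans2017, arXiv:1712.02302,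
lean:Literature.Barriers.MatrixMultiplication.BCCGU2017_thm42, CohnUmans2003]
#9 ThresholdIffNotCensus (support, NEW 2026-08-15, provable now) — bookkeeping, pure logic (push_neg
/ not_lt): NoThresholdSubgroupTriple ↔ ¬ThresholdSubgroupTriples; the route is decided by exactly
one of the target and N. [CohnKleinbergSzegedyUmans2005, BlasiakChurchCohnGrochowUmans2017]
#9 VershikKerovBound (support; hypothesis of `closes`; shared with route SnSubsetDichotomy) — known
theorem, named-fact style (cite filed for vendoring into Literature/RepresentationTheory): ∃ c > 0,
n₀ with d_max(S_n) ≤ √(n!)·e^{−c√n} for n ≥ n₀ (VershikKerov1985 Thm 1, order-sharp two-sided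
bounds; hook formula + Logan–Shepp/Vershik–Kerov limit shape). [difficulty: XL] [VershikKerov1985,
LoganShepp1977, JamesKerber1981]
#9 PairwiseTrivialAtThreshold (support) — pairwise-trivial subgroup triples DO reach the threshold
up to poly(n) (so N needs the triple condition; = sibling card hyperoctahedral-matching-tpp Obs.
1–2, the S_n-internal form of BCCGU's S_n × S_n remark): ∃ C, for infinitely many n there are
H₁,H₂,H₃ ≤ S_n with pairwise trivial intersections and (n!)^{3/2} ≤ n^C |H₁||H₂||H₃|. Witness: n =
2m, m odd, matchings M_a = {{x, a−x}} on ℤ/2m for a = 1, 3, 5 (pairwise Hamiltonian unions), Hᵢ =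
B(M_{aᵢ}) ∩ Stab(0), |Hᵢ| = 2^{m−1}(m−1)! = |B_m|/n, dihedral lemma ⇒ Hᵢ ∩ Hⱼ = 1, C = 3.
[difficulty: M] [BlasiakChurchCohnGrochowUmans2017, arXiv:1712.02302]
#1 Assembly (assembly; RESTATED 2026-08-15, provable now) — ThresholdSubgroupTriples →
VershikKerovBound → MatrixMultiplication, the deciding implication as a Prop: exactly the type of
the proved `closes`, so `theorem Assembly_holds : Assembly := closes` closes it; it replaces the
hypothesis form ¬N → CKSU2005_cor19 → VershikKerovBound → summit, whose two non-item hypotheses were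
the gate bounce (¬N is now the target, Cor 1.9 is the tree theorem `CKSU2005_cor19_holds`).
[difficulty: provable-now] [CohnKleinbergSzegedyUmans2005, VershikKerov1985,
BlasiakChurchCohnGrochowUmans2017]

TWO-LAYER PLAN. Foreseen glued splits (k ≤ 3, depth 1), filed only when a crux is staffed/closes:
HyperoctahedralTriples ⇐ IndexReduction (WLOG
Kᵢ ⊇ even core (ℤ/2)^{m'}_{ev} ⋊ A_{m'} on n − O(√n/log n) points, via subgroups of small index in
B_m) → RootedOrbitSeparation
(TPP ⇔ K₃-orbit of M₂ avoids K₁·M₂; count violations by the Gelfand pair (S_{2m}, B_m) / zonal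
spherical functions or by the
global-hypercontractivity engine of card global-hypercontractivity-tpp-dichotomy) →
HyperoctahedralTriples. Recommended FIRST child on
either side (tenure): the rooted knife edge in its simplest instance — RootedTriplesFail (∃ n₀ ∀ n ≥
n₀, for three perfect matchings
with a common root v the rooted stabilisers B(Mᵢ) ∩ Stab(v) violate the subgroup TPP; implied by
HyperoctahedralTriples since |K|³ =
(n!)^{3/2}(πn/2)^{3/4}n^{−3} ≫ (n!)^{3/2}e^{−c√n}; pairwise tools provably useless there, margin
only n^{3/4} inside Sym(n−1)) versus
its negation RootedMatchingTPP (TPP rooted triples for infinitely many n), which proves X with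
polynomial slack via a support estimate
(2^{m−1}(m−1)!)³ > (n!)^{3/2}e^{−c√n}. PartitionHostTriples ⇐ YoungLikeHosts
(AlmostDisjointYoungBound + normaliser barrier for cores
with s ≥ e^{√n}) → MixedHosts (S_D × B, reduce to rank 2) → PartitionHostTriples. CensusReduction ⇐
GiantBlockRegime (A_D ≤ H₁, |D|
≥ n/4: partners forced to meet) → DiagonalRegime (A_D × diag S_m and subdirect products) →
CensusReduction.

KILL CRITERIA. The route is decided either way and both endings are informative. N PROVED (via ranks
3+4, or directly) ⇒ the target X is
refuted in one line (ThresholdIffNotCensus); the gate flips the route BROKEN and the tenure planner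
closes it
`refuted:ThresholdSubgroupTriples` — milestone reached, theorems kept: N enters the negatives-side
knowledge of CNonabelianTPPFamilies
(S_n and A_n subgroup hosts dead; subsets remain for route SnSubsetDichotomy / card
global-hypercontractivity-tpp-dichotomy). X PROVED
(equivalently HyperoctahedralTriples, PartitionHostTriples or N REFUTED by a threshold TPP family) ⇒
with VershikKerovBound the deciding
theorem `closes` yields ω(ℂ) = 2, the summit; hand the witness family to route GroupTheoreticSTPP as
a proof of CNonabelianTPPFamilies
with G = S_n. VershikKerovBound is a published theorem (VershikKerov1985 Thm 1); should its Lean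
form fail on a technicality of
`maxCharDegree` (an sSup over `charDegrees`, a genuine maximum once `sq_charDegree_le` is available)
restate it, do not close.
AlmostDisjointYoungBound refuted by a doubled shape with deficit e^{o(n)} ⇒ pivot, not close:
restate it with the deficit that shape
allows (any e^{C'√n log n} with C' above the host-cap loss still serves rank 3, below that rank 3
must lean on the normaliser barrier
for those shapes) — a tenure decision. A proof elsewhere that S_n has slice rank ≤ n!/e^{Ω(√n)}-type
bounds for subsets proves N and
ends the route the same way (refuted target, milestone superseded by the stronger subset statement
of SnSubsetDichotomy).

NOT DECOMPOSED YET. Deliberately NOT filed: the rooted knife-edge pair RootedTriplesFail /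
RootedMatchingTPP (see TWO-LAYER PLAN; first split
of HyperoctahedralTriples, and the constructive twin's entry point — filed at tenure, not in this
repair); the structure theorem for
balanced subgroups of S_n (host / giant-block / diagonal trichotomy) — the card's version (normal N
= ∏A_{mᵢ}, index e^{O(√n)}) is
false (B_m, S_a ≀ S_b, A_{n/2} × Syl₂, A_D × diag S_m are balanced counterexamples), and the true
statement is best discovered inside
CensusReduction; the Gelfand-pair count for three conjugates of B_m (card crux 3: moot for full B_m,
which fails pairwise, and
unformulated for its subgroups — a layer-2 child of rank 2); the strong 'proves nothing at all' form
n!/(|H₁||H₂||H₃|)^{2/3} ≥ p(n)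
(Prop 2.4 currency); the A_n variant (numerically covered: subgroups of A_n are subgroups of S_n,
|A_n| = n!/2); explicit constants;
certified small-n computations (refuter falsifier). Vendoring VershikKerov1985 as a Literature fact
is a cite item, not a route item.

CHEAPEST FALSIFIER. GAP/kit search at n = 8, 10, 12 (|S_12| = 4.8·10^8; B_6 has order 46080): the
largest subgroup TPP triple (K₁,K₂,K₃) with Kᵢ inside
three matching stabilisers B(Mᵢ), over all matching triples up to symmetry, compared with
(n!)^{3/2}, with n^{-3}(n!)^{3/2} (the
pairwise-trivial rooted triple) and with the best Young triple (BCCGU triangle/hexagon). Rooted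
triples satisfying TPP at n = 10, 12,
or hyperoctahedral sub-triples beating Young ones with a growing trend, would put rank 2 (and N) in
danger and X, hence ω = 2 by
`closes`, in sight; uniformly worse-than-Young data morally confirms rank 2. Not run here (hub
compute-free); the card's n = 6, 8
script counted only FULL conjugate-B_m triples, which fail pairwise since |B_m|² > n! — so no
informative data exists yet.

NUMBERS. |B_m| = 2^m m! = √(n!)(πn/2)^{1/4}(1+o(1)) (n = 2m), hence |B_m|² > n! and two conjugates
of B_m always meet non-trivially;
rooted stabiliser K = B(M) ∩ Stab(v₀): |K| = |B_m|/n, three pairwise-trivial ones give |K|³ =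
(n!)^{3/2}(πn/2)^{3/4}n^{−3}.
d_max(S_n) = √(n!)e^{−Θ(√n)} (VershikKerov1985, two-sided, order-sharp); p(n) = #classes(S_n) =
e^{π√(2n/3)(1+o(1))}; deciding-theorem
arithmetic (as proved): with ε = ω − 2 and c = c₁ε, N^{ω/3} ≤ (n!)^{ω/2}e^{−c₁ε√n} < N^{ω/3} unless
ω = 2 (uses only 2 ≤ ω ≤ 3); in
general N ≥ (n!)^{3/2}e^{−c√n} and d_max ≤ √(n!)e^{−c₁√n} certify ω ≤ 2/(1 − c/(3c₁)). Young
triples: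
n!/(|H₁||H₂||H₃|)^{2/3} ≥ e^{cn − d√n log n} (BlasiakChurchCohnGrochowUmans2017 Thm 4.2; proof
constants c ≤ 0.02, cases t > 0.9n,
t < e^{0.49√n}). Balanced non-Young examples (log-orders vs ½ log n! = ½ n log n − n/2 + O(log n)):
S_a ≀ S_b with a = √(en):
+Θ(√n log n); (n/2)! = √(n!)·e^{−(log 2/2)n + o(n)} and |Syl₂(S_{n/2})| = 2^{n/2 − O(log n)} =
e^{(log 2/2)n − O(log n)}, so
A_{n/2} × Syl₂ is balanced; A_D × diag(S_m), 2m + |D| = n, is balanced for |D| ≈ (log 2/2)·n/log n.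
Items after the repair: 10
(target, 5 cruxes incl. the rank-0 negative side N, 3 support, assembly) + the proved deciding
theorem `closes`.

DEFINITION REQUESTS. None: perfect matchings are fixed-point-free involutions μ (B(M) =
`Subgroup.centralizer {μ}`), hosts are stated through
labellings f : Fin n → Fin n, the subgroup TPP is the tree's
`Literature.Barriers.MatrixMultiplication.SubgroupTPP`. Facts: CKSU 2005
Cor 1.9 is PROVED in the tree (`Literature.Computability.AlgebraicComplexity.CKSU2005_cor19_holds`,
CohnUmansTPPProofs.lean, now
imported) — needs-fact: NONE for the deciding theorem. Cite/fact still wanted (kind cite, not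
load-bearing for elaboration):
VershikKerov1985 Thm 1 — two-sided bounds e^{−c₂√n}√(n!) ≤ maxCharDegree(S_n) ≤ e^{−c₁√n}√(n!) — as
a Literature theorem over
`maxCharDegree (Equiv.Perm (Fin n))`, which would close the support item VershikKerovBound; provers
of CensusReduction may further
want DixonMortimer1996 Thm 5.2A/B (subgroups of S_n of index < C(n,r)) and the primitive-group order
bound |H| < 4ⁿ unless H ≥ A_n
(PraegerSaxl1980; sharper Maroti2002) as cite facts.

Novelty: Searches (2026-08-15): `lit search --source zbmath "triple product property matrix multiplication
group"` (8: Neumann2011,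
Hedtke2011 = arXiv:1107.5969, HedtkeMurthy2012, Hedtke2015, Hart–Hedtke–Müller-Hannemann–Murthy
2015, arXiv:2410.14905, 2 noise);
`lit search --source zbmath "triple product property symmetric group subgroups"` (0 relevant); `lit
citing arxiv:1712.02302 --since
2018` (23 works, none on S_n subgroup triples; nearest arXiv:2204.03826 §3, arXiv:2210.05488,
arXiv:2410.14905); `lit galaxy search
"triple product property" --star all` (13: Stothers thesis, CKSU05, BCGPU ITCS2025, Sawin
arXiv:1702.00905); `lit galaxy search
"hyperoctahedral group" --star pdf` (8, none on TPP); zbMATH review of VershikKerov1985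
(doi:10.1007/bf01086021); held texts READ:
arXiv:1712.02302 §4–5 (pp. 9–11: Thm 4.2 + proof, S_n × S_n remark, §5 open questions),
arXiv:1107.5969 (full), arXiv:1107.5973
(grep). OpenAlex and arXiv APIs returned HTTP 429 all session (logged); local searchd reset once.
Nearest prior art found: BlasiakChurchCohnGrochowUmans2017 (arXiv:1712.02302) Thm 4.2 + §5 — Young
case, and the target is their
posed open step; Hedtke2011 (arXiv:1107.5969) — TPP SUBGROUP capacity β_g(G), Neumann2011's
|S|(|T|+|U|−1) ≤ |G|, the core bound
|S||T||U| ≤ |S|·|G|/|Core_G(S)|, the folklore conjecture "triples of subgroups will never lead to a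
nontrivial upper bound for ω",
data for |G| ≤ 1000 (HedtkeMurthy2012, Hedtke2015); BlasiakCohnGrochowPrattUmans2023
(arXiv:2204.03826) Thm 3  [refs: 10.1007/bf01086021, 1107.5969, 2410.14905, 1712.02302, 2204.03826, 2210.05488, 1702.00905, 1107.5973, arxiv:1712.02302, doi:10.1007/bf01086021, Neumann2011, Hedtke2011, HedtkeMurthy2012, Hedtke2015, VershikKerov1985, BlasiakChurchCohnGrochowUmans2017, BlasiakCohnGrochowPrattUmans2023]

Barriers (technique_class: subgroup-TPP-in-Sn, large-subgroups, partition-hosts): - technique_class: subgroup-TPP-in-Sn, large-subgroups, partition-hosts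
- Literature.Barriers.MatrixMultiplication.YoungSubgroupBarrier: not evaded — GENERALISED (the route
is the negative side): AlmostDisjointYoungBound extends `BCCGU2017_thm42` from discrete meets to
meets ≤ 2, PartitionHostTriples extends Young subgroups S_λ to capped hosts N(S_λ) and their
subgroups; the kill link is precisely the barrier's evasions_known clause (sets of size ≥
√(n!)/e^{o(√n)} prove ω = 2).
- Literature.Barriers.MatrixMultiplication.NormalizerBarrier: an ALLY, not an obstacle:
`SubgroupTPP.normalizer_barrier` (proved) disposes of sub-Young cores with normaliser quotient
e^{Ω(√n log n)} ((A_a)^b inside S_a ≀ S_b); it is void on the knife edge because B(M) is maximal and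
self-normalising (sᵢ = 1) — the reason HyperoctahedralTriples is rank 2.
- Literature.Barriers.MatrixMultiplication.QuasirandomBarrier: void in S_n (n(S_n) = n − 1 costs
only √(n−1), inside the e^{o(√n)} slack); not used.
- Literature.Barriers.MatrixMultiplication.NilpotentGroupBarrier: n/a — single TPP triples in one
S_n per n, no powers, no bounded exponent; a future slice-rank bound for S_n of BCCGU §5's 'most
ambitious' type would imply the target for subsets and supersede the route.
- Literature.Barriers.MatrixMultiplication.TricoloredSumFreeBarrier: n/a — non-abelian, no STPP
family, no bounded-exponent abelian host.
- Literature.Barriers.MatrixMultiplication.InfimumNotMinimumBarrier: respected by the kill link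
(each

History (route lifecycle, newest last):
- 2026-08-15T16:26:38Z · rev 3: restated CensusReduction (stmt-MatrixMultiplication-5538) — un-block CensusReduction (gate flagged missing decl NoThresholdSubgroupTriple at rev 1 while it was briefly kind support); the decl renders before it again (cru (planner-rbadge-MatrixMultiplication-SnThreshol-56ec3076-g2-0)
- 2026-08-15T16:28:23Z · rev 5: restated Assembly (stmt-MatrixMultiplication-5542) — repair: Assembly restated from the hypothesis form (¬N → CKSU2005_cor19 → VK → summit; extra-hypothesis bounce) to the deciding implication ThresholdSubgroupTri (planner-rbadge-MatrixMultiplication-SnThreshol-56ec3076-g2-0)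
- 2026-08-16T04:11:19Z · AUTO-CRUX (backfill): ThresholdSubgroupTriples — hypotheses of the deciding theorem that nothing in the route derives are cruxes (operator:999:1085951)
- 2026-08-16T08:20:38Z · BROKEN — ThresholdSubgroupTriples (stmt-MatrixMultiplication-10879, crux) refuted by Summit.MatrixMultiplication.MatrixMultiplication.Theorems.SnThresholdCensusThresholdSubgroupTriples_refuted @ 105c308e4a4b (refuter-cruxtri-stmt-MatrixMultiplication-10883-r1-1-0)
- 2026-08-16T08:27:47Z · CLOSED refuted — refuted:stmt-MatrixMultiplication-10879 (ThresholdSubgroupTriples) by Summit.MatrixMultiplication.MatrixMultiplication.Theorems.SnThresholdCensusThresholdSubgroupTriples_refuted (planner-rchoice-MatrixMultiplication-SnThresho-4dc7a448-0)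

sub-problem: MatrixMultiplication · status: closed(refuted) · opened planner-plancard-MatrixMultiplication-MatrixM-3e6dc8d5-0 2026-08-15T11:41:30Z · rev 6 · ledger route-MatrixMultiplication-SnThresholdCensus
GENERATED by the gate from the ledger (D-0016/17). Provers cite these decls: `theorem foo : Summit.MatrixMultiplication.MatrixMultiplication.Theses.SnThresholdCensus.<Decl> := …` in Summits/MatrixMultiplication/MatrixMultiplication/Theorems/<Name>.lean.
-/

namespace Summit.MatrixMultiplication.MatrixMultiplication.Theses.SnThresholdCensus

open scoped BigOperators Topology Manifold Classical MeasureTheory ProbabilityTheory Matrix InnerProductSpace ComplexConjugate ContinuousMap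
open Filter Set Function TopologicalSpace MeasureTheory

attribute [summit_statement] _root_.MatrixMultiplication

/-- item stmt-MatrixMultiplication-10879 · crux (kind.auto-crux: conjecture-grade) · rank 0 · closed · refuted by Summit.MatrixMultiplication.MatrixMultiplication.Theorems.SnThresholdCensusThresholdSubgroupTriples_refuted @ 105c308e4a4b (refuter) · by planner
why it might fail: Probably false: it is ¬N, and the census (ranks 2–5) is built to prove N — Young triples lose e^{Ω(n)} (BCCGU17 Thm 4.2), folklore says subgroup triples never help (Hedtke2011), a balanced triple expects ≈ √(n!)·n^{−3/2} TPP violations; only a hyperoctahedral knife-edge miracle saves it.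
sources: BlasiakChurchCohnGrochowUmans2017, arXiv:1712.02302, CohnKleinbergSzegedyUmans2005, Hedtke2011, arXiv:1107.5969, VershikKerov1985
THRESHOLD SUBGROUP TRIPLES — the deciding statement X of § Thesis (D-0027 route repair 2026-08-15;
positive form of ¬NoThresholdSubgroupTriple; card hyperoctahedral-matching-tpp C2 for subgroups of
arbitrary hosts): for every c > 0 and n₀ there are n ≥ n₀ and subgroups H₁, H₂, H₃ ≤ S_n with the
subgroup TPP and |H₁||H₂||H₃| > (n!)^{3/2} e^{−c√n}. Hypothesis of the proved deciding theorem
`closes : ThresholdSubgroupTriples → VershikKerovBound → MatrixMultiplication` (Cor 1.9 = tree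
`CKSU2005_cor19_holds` inside). Every refutation of a census crux (ranks 2–5) proves it; a proof of
N refutes it (ThresholdIffNotCensus). -/
@[route_item "route-MatrixMultiplication-SnThresholdCensus"]
def ThresholdSubgroupTriples : Prop :=
  ∀ c : ℝ, 0 < c → ∀ n₀ : ℕ, ∃ n ≥ n₀, ∃ H : Fin 3 → Subgroup (Equiv.Perm (Fin n)), Literature.Barriers.MatrixMultiplication.SubgroupTPP (H 0) (H 1) (H 2) ∧ (n.factorial : ℝ) ^ ((3 : ℝ) / 2) * Real.exp (-(c * Real.sqrt (n : ℝ))) < ((Nat.card (H 0) * Nat.card (H 1) * Nat.card (H 2) : ℕ) : ℝ)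

/-- item stmt-MatrixMultiplication-5535 · crux · rank 0 · closed · moot by None · by planner
why it might fail: May be false exactly on the hyperoctahedral knife edge: rooted matching stabilisers are pairwise trivial at (n!)^{3/2}/n³, so only the genuine triple condition separates N from ω = 2, and no technique for non-Young subgroups of S_n exists (BCCGU17 §5 open question).
sources: BlasiakChurchCohnGrochowUmans2017, arXiv:1712.02302, Hedtke2011, arXiv:1107.5969, BlasiakCohnGrochowPrattUmans2023, lean:Literature.Barriers.MatrixMultiplication.BCCGU2017_thm42
[target] X as in § Thesis: ∃ c > 0, n₀ such that for n ≥ n₀ every subgroup triple of S_n with the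
subgroup TPP has |H₁||H₂||H₃| ≤ (n!)^{3/2} e^{−c√n} (card sn-threshold-subgroup-census, target; the
S_n / A_n subgroup-host half of CNonabelianTPPFamilies). -/
@[route_item "route-MatrixMultiplication-SnThresholdCensus"]
def NoThresholdSubgroupTriple : Prop :=
  ∃ c : ℝ, 0 < c ∧ ∃ n₀ : ℕ, ∀ n ≥ n₀, ∀ H : Fin 3 → Subgroup (Equiv.Perm (Fin n)), Literature.Barriers.MatrixMultiplication.SubgroupTPP (H 0) (H 1) (H 2) → ((Nat.card (H 0) * Nat.card (H 1) * Nat.card (H 2) : ℕ) : ℝ) ≤ (n.factorial : ℝ) ^ ((3 : ℝ) / 2) * Real.exp (-(c * Real.sqrt (n : ℝ)))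

/-- item stmt-MatrixMultiplication-5536 · crux · rank 2 · closed · moot by None · by planner
why it might fail: Pairwise counting is exhausted (Kᵢ = B(Mᵢ) ∩ Stab(v₀) pairwise trivial, only n³ below (n!)^{3/2}); B(M) is maximal and self-normalising so Thm 3.6 gives nothing; if one matching triple satisfies (HAM) orbit separation the crux is false and ω = 2 follows.
sources: BlasiakChurchCohnGrochowUmans2017, BlasiakCohnGrochowPrattUmans2023, Macdonald1995, JamesKerber1981, lean:Literature.Barriers.MatrixMultiplication.SubgroupTPP.normalizer_barrier
[crux] the knife-edge family (card crux 3 corrected to SUBGROUPS of matching stabilisers; = sibling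
card hyperoctahedral-matching-tpp C2 for subgroups): ∃ c > 0, n₀: for n ≥ n₀, three fixed-point-free
involutions μᵢ (perfect matchings Mᵢ) and subgroups Kᵢ ≤ C(μᵢ) = B(Mᵢ) ≅ S_2 ≀ S_{n/2} with the
subgroup TPP have |K₁||K₂||K₃| ≤ (n!)^{3/2} e^{−c√n}. Full conjugates of B_m fail already pairwise
(|B_m|² > n!); the content is index-≤ e^{O(√n)} subgroups such as the rooted stabilisers B(Mᵢ) ∩
Stab(v₀). [difficulty: open-problem] -/
@[route_item "route-MatrixMultiplication-SnThresholdCensus"]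
def HyperoctahedralTriples : Prop :=
  ∃ c : ℝ, 0 < c ∧ ∃ n₀ : ℕ, ∀ n ≥ n₀, ∀ μ : Fin 3 → Equiv.Perm (Fin n), (∀ i, μ i * μ i = 1 ∧ ∀ x, μ i x ≠ x) → ∀ K : Fin 3 → Subgroup (Equiv.Perm (Fin n)), (∀ i, K i ≤ Subgroup.centralizer {μ i}) → Literature.Barriers.MatrixMultiplication.SubgroupTPP (K 0) (K 1) (K 2) → ((Nat.card (K 0) * Nat.card (K 1) * Nat.card (K 2) : ℕ) : ℝ) ≤ (n.factorial : ℝ) ^ ((3 : ℝ) / 2) * Real.exp (-(c * Real.sqrt (n : ℝ)))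

/-- item stmt-MatrixMultiplication-5537 · crux · rank 3 · closed · moot by None · by planner
why it might fail: Hosts up to √(n!)e^{C√n log n} include S_a ≀ S_b (a ≈ √(en)) whose block-permuting top is not Young: BCCGU's induction controls parts, not twisted/diagonal subgroups of the base, and mixed hosts S_D × B inherit the full hyperoctahedral difficulty of rank 2.
sources: BlasiakChurchCohnGrochowUmans2017, DixonMortimer1996, BlasiakCohnGrochowPrattUmans2023, lean:Literature.Barriers.MatrixMultiplication.SubgroupTPP.normalizer_barrier, lean:Literature.Barriers.MatrixMultiplication.youngSubgroup
[crux] capped partition hosts (card cruxes 1–2, Young-like + hyperoctahedral + mixed types in one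
host notion): for every C there are c > 0, n₀ such that for n ≥ n₀, labellings f₁,f₂,f₃ : [n] → [n]
whose hosts N(S_{fᵢ}) = {σ : σ maps fibres of fᵢ to fibres} have order ≤ √(n!)·e^{C√n log n}, and
subgroups Kᵢ ≤ N(S_{fᵢ}) with the subgroup TPP: |K₁||K₂||K₃| ≤ (n!)^{3/2} e^{−c√n}. Hosts include
S_λ and S_a ≀ S_b (a ≤ (√e+o(1))√n), B_m (fibres = pairs), S_D × B (|D| ≈ √n); implies
HyperoctahedralTriples. [deps: HyperoctahedralTriples, AlmostDisjointYoungBound] [difficulty: XL] -/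
@[route_item "route-MatrixMultiplication-SnThresholdCensus"]
def PartitionHostTriples : Prop :=
  ∀ C : ℝ, ∃ c : ℝ, 0 < c ∧ ∃ n₀ : ℕ, ∀ n ≥ n₀, ∀ f : Fin 3 → Fin n → Fin n, (∀ i, (Nat.card {σ : Equiv.Perm (Fin n) // ∃ τ : Equiv.Perm (Fin n), ∀ x, f i (σ x) = τ (f i x)} : ℝ) ≤ Real.sqrt (n.factorial : ℝ) * Real.exp (C * Real.sqrt (n : ℝ) * Real.log (n : ℝ))) → ∀ K : Fin 3 → Subgroup (Equiv.Perm (Fin n)), (∀ i, ∀ σ ∈ K i, ∃ τ : Equiv.Perm (Fin n), ∀ x, f i (σ x) = τ (f i x)) → Literature.Barriers.MatrixMultiplication.SubgroupTPP (K 0) (K 1) (K 2) → ((Nat.card (K 0) * Nat.card (K 1) * Nat.card (K 2) : ℕ) : ℝ) ≤ (n.factorial : ℝ) ^ ((3 : ℝ) / 2) * Real.exp (-(c * Real.sqrt (n : ℝ)))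

-- earlier CensusReduction (stmt-MatrixMultiplication-5538, replaced 2026-08-15T16:26:38Z -> stmt-MatrixMultiplication-10864): retired by None — PartitionHostTriples → NoThresholdSubgroupTriple
/-- item stmt-MatrixMultiplication-10864 · crux · rank 4 · closed · moot by None · by planner
why it might fail: A third balanced family may escape both clauses: giant blocks with thin junk (A_{n/2} × Syl₂), diagonal type A_D × diag(S_m) — BCCGU's S_n × S_n warning realised inside S_n — and subdirect products each need their own forced-intersection argument, none written.
sources: DixonMortimer1996, PraegerSaxl1980, Maroti2002, BlasiakChurchCohnGrochowUmans2017, Hedtke2011, Neumann2011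
[crux] the census proper (card crux 1 in checkable form): PartitionHostTriples ⇒ X. Content: by
pairwise counting only balanced triples matter (all |Hᵢ| = √(n!)e^{±O(√n)}); a balanced subgroup
outside every capped partition host is of giant-block type (A_D ≤ H with |D| ≥ n/2 − O(n/log n) and
thin junk, e.g. A_{n/2} × Syl₂), of diagonal type (A_D × diag(S_m) ≤ S_D × S_m × S_m) or a subdirect
mixture, and such subgroups admit no threshold TPP partners (forced intersections: partners must
avoid A_D yet have index e^{O(√n)}·n^{1/4} in some B(M) with M crossing D, whose diagonal S_{n/2}
then meets any thin junk). [deps: PartitionHostTriples] [difficulty: L] -/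
@[route_item "route-MatrixMultiplication-SnThresholdCensus"]
def CensusReduction : Prop :=
  (PartitionHostTriples → NoThresholdSubgroupTriple)

/-- item stmt-MatrixMultiplication-5539 · crux · rank 5 · closed · moot by None · by planner
why it might fail: With meets of size 2 the t-large step of BCCGU's induction breaks (the other partitions need only t/2 parts) and doubled shapes (rows / columns / doubled diagonals of a √n-grid) gain 4^n-type factors, so c must drop below BCCGU's; an unforeseen doubled shape could push the deficit to e^{o(n)}.
sources: BlasiakChurchCohnGrochowUmans2017, arXiv:1712.02302, lean:Literature.Barriers.MatrixMultiplication.BCCGU2017_thm42, CohnUmans2003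
[crux] BCCGU Thm 4.2 with meets of size ≤ 2 (the engine for the Young-like part of rank 3): ∃ c, d >
0 such that for n ≥ 2 and labellings f₁,f₂,f₃ : [n] → [n] whose pairwise meet fibres {x : fᵢx = a,
fⱼx = b} (i ≠ j) have ≤ 2 elements, n!/(∏ᵢ∏ₐ |fᵢ⁻¹(a)|!)^{2/3} ≥ e^{cn − d√n log n}. Group meaning:
alternating Young cores A(λᵢ) := ∏_B A_B ≤ Hᵢ ≤ S(λᵢ) with Hᵢ ∩ Hⱼ = 1 force meets ≤ 2, and |S(λ)| =
∏|B|!; the vendored BCCGU2017_thm42 is the case of meets ≤ 1. [difficulty: L] -/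
@[route_item "route-MatrixMultiplication-SnThresholdCensus"]
def AlmostDisjointYoungBound : Prop :=
  ∃ c d : ℝ, 0 < c ∧ 0 < d ∧ ∀ n : ℕ, 2 ≤ n → ∀ f : Fin 3 → Fin n → Fin n, (∀ i j, i ≠ j → ∀ a b : Fin n, (Finset.univ.filter (fun x => f i x = a ∧ f j x = b)).card ≤ 2) → Real.exp (c * n - d * Real.sqrt (n : ℝ) * Real.log (n : ℝ)) ≤ (n.factorial : ℝ) / ((∏ i, ∏ a, ((Finset.univ.filter (fun x => f i x = a)).card).factorial : ℕ) : ℝ) ^ ((2 : ℝ) / 3)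

/-- item stmt-MatrixMultiplication-10880 · support · rank 9 · closed · moot by None · by planner
sources: CohnKleinbergSzegedyUmans2005, BlasiakChurchCohnGrochowUmans2017
bookkeeping, provable now (pure logic: push_neg, not_lt/not_le): the census statement N =
NoThresholdSubgroupTriple is literally the negation of the target, so the route is decided by
exactly one of the two; a proof of N is a one-line refutation of ThresholdSubgroupTriples.
[difficulty: provable-now] -/
@[route_item "route-MatrixMultiplication-SnThresholdCensus"]
def ThresholdIffNotCensus : Prop :=
  NoThresholdSubgroupTriple ↔ ¬ ThresholdSubgroupTriples

/-- item stmt-MatrixMultiplication-5540 · support · rank 9 · closed · proved by Summit.MatrixMultiplication.MatrixMultiplication.Theorems.vershikKerovBound_proof (prover) · by planner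
sources: VershikKerov1985, LoganShepp1977, JamesKerber1981
[support] known theorem, named-fact style, used only by the kill link (cite filed for vendoring into
Literature/RepresentationTheory): ∃ c > 0, n₀ with d_max(S_n) ≤ √(n!)·e^{−c√n} for n ≥ n₀
(VershikKerov1985 Thm 1, order-sharp two-sided bounds; hook formula + Logan–Shepp/Vershik–Kerov
limit shape). [difficulty: XL] -/
@[route_item "route-MatrixMultiplication-SnThresholdCensus"]
def VershikKerovBound : Prop :=
  ∃ c : ℝ, 0 < c ∧ ∃ n₀ : ℕ, ∀ n ≥ n₀, (Literature.RepresentationTheory.FiniteGroups.maxCharDegree (Equiv.Perm (Fin n)) : ℝ) ≤ Real.sqrt (n.factorial : ℝ) * Real.exp (-(c * Real.sqrt (n : ℝ)))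

/-- item stmt-MatrixMultiplication-5541 · support · rank 9 · closed · moot by None · by planner
sources: BlasiakChurchCohnGrochowUmans2017, arXiv:1712.02302
[support] pairwise-trivial subgroup triples DO reach the threshold up to poly(n) (so X needs the
triple condition; = sibling card hyperoctahedral-matching-tpp Obs. 1–2, the S_n-internal form of
BCCGU's S_n × S_n remark): ∃ C, for infinitely many n there are H₁,H₂,H₃ ≤ S_n with pairwise trivial
intersections and (n!)^{3/2} ≤ n^C |H₁||H₂||H₃|. Witness: n = 2m, m odd, matchings M_a = {{x, a−x}}
on ℤ/2m for a = 1, 3, 5 (pairwise Hamiltonian unions), Hᵢ = B(M_{aᵢ}) ∩ Stab(0), |Hᵢ| =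
2^{m−1}(m−1)! = |B_m|/n, dihedral lemma ⇒ Hᵢ ∩ Hⱼ = 1, C = 3. [difficulty: M] -/
@[route_item "route-MatrixMultiplication-SnThresholdCensus"]
def PairwiseTrivialAtThreshold : Prop :=
  ∃ C : ℝ, ∀ n₀ : ℕ, ∃ n ≥ n₀, ∃ H : Fin 3 → Subgroup (Equiv.Perm (Fin n)), (∀ i j, i ≠ j → H i ⊓ H j = ⊥) ∧ (n.factorial : ℝ) ^ ((3 : ℝ) / 2) ≤ (n : ℝ) ^ C * ((Nat.card (H 0) * Nat.card (H 1) * Nat.card (H 2) : ℕ) : ℝ)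

-- earlier Assembly (stmt-MatrixMultiplication-5542, replaced 2026-08-15T16:28:23Z -> stmt-MatrixMultiplication-10891): retired by None — ¬ NoThresholdSubgroupTriple → Literature.Computability.AlgebraicComplexity.CKSU2005_cor19 → VershikKerovBound → MatrixMultiplication
/-- item stmt-MatrixMultiplication-10891 · assembly · rank 1 · closed · moot by None · by planner
sources: CohnKleinbergSzegedyUmans2005, CohnUmans2003, VershikKerov1985, BlasiakChurchCohnGrochowUmans2017
the deciding implication as a Prop (restated 2026-08-15, D-0027 route repair): exactly the type of
the proved deciding theorem `closes`, so `theorem Assembly_holds : Assembly := closes` closes it;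
replaces the hypothesis form ¬N → CKSU2005_cor19 → VershikKerovBound → summit, whose two non-item
hypotheses were the gate bounce (¬N is now the target ThresholdSubgroupTriples, CKSU Cor 1.9 is the
tree theorem CKSU2005_cor19_holds). [difficulty: provable-now] -/
@[route_item "route-MatrixMultiplication-SnThresholdCensus"]
def Assembly : Prop :=
  ThresholdSubgroupTriples → VershikKerovBound → MatrixMultiplication

end Summit.MatrixMultiplication.MatrixMultiplication.Theses.SnThresholdCensus
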